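import Literature.NumberTheory.Transcendental.LinGroupKTransport
import Literature.NumberTheory.Transcendental.LinGroupDerivations
import Literature.FieldTheory.AlgClosed.PadicAlgClEquivComplex
import HarnessLib

/-!
# The `𝔾ₐ^{d₀} × 𝔾ₘ^{d₁}` vocabulary over `ℂ`: dictionary with `LinGroup`, and the zero estimate over `ℚ̄_p` from the complex one

Topic `Literature/NumberTheory/Transcendental` (namespace `Literature.NumberTheory.Transcendental`,
grouping sub-namespace `LinGroupK`). Everything here is PROVED; two definitions with bodies (the
identifications of the two structures of connected algebraic subgroups); no named facts.

* For `K = ℂ` the generic vocabulary of `LinGroupK.lean` IS the tree's complex vocabulary of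
  `LinGroup.lean` / `LinGroupDerivations.lean`: the types `LinGroupK ℂ d₀ d₁ = LinGroup d₀ d₁`, the
  functions `coord`, `evalAt`, `degX`, `degY`, `invDeriv`, `wordDeriv`, `sumset` agree
  definitionally (`rfl` lemmas), the connected algebraic subgroups correspond by
  `ConnAlgSubgroup.toLin` / `ofLin` with the same points, Lie algebras and dimensions, and the
  ALGEBRAIC order of vanishing `VanishesAlg` is the tree's ANALYTIC `LinGroup.VanishesToOrder`
  (`vanishesAlg_iff_vanishesToOrder`, by the tree's `LinGroup.vanishesToOrder_iff_wordDeriv`,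
  [NesterenkoPhilippon2001, Ch. 11, Lemma 3.3]).
* `zeroEstimate_complex_iff` — hence the predicate `LinGroupK.ZeroEstimate ℂ d₀ d₁` is EQUIVALENT to
  the zero-estimate hypothesis `hZE` of the tree's complex assembly
  `LinGroup.weakObstruction_of_zeroEstimate_of_auxiliary` ([Philippon1986, Thm 2.1] for
  `𝔾ₐ^{d₀} × 𝔾ₘ^{d₁}`, [Waldschmidt1988, Prop. 7.1]) prefixed by `∃ c`.
* `zeroEstimate_padicAlgCl_of_complex` — and, Philippon's theorem being purely algebraic
  ("`K = ℂ` (ou `ℂ_ℓ`)", [Philippon1986, §2]), the complex zero estimate on `𝔾ₐ^{d₀} × 𝔾ₘ^{d₁}`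
  implies the `p`-adic one over `ℚ̄_p = PadicAlgCl p`, by transport along an abstract field
  isomorphism `ℂ ≃+* ℚ̄_p` (`Complex.nonempty_ringEquiv_padicAlgCl`, Steinitz) and
  `LinGroupK.ZeroEstimate.of_ringEquiv`.

Nothing is asserted about the zero estimate itself: over `ℂ` it is a theorem of the tree for
`d₀ = 1` (`Philippon1986_GaGm_holds`, group `𝔾ₐ × 𝔾ₘ^m`) and owed in general to the companion
files of `Literature.Barriers.Schanuel.roy1992_thm1`; the present file turns any such complex
theorem into its `p`-adic counterpart, needed by the `p`-adic case of Roy's Theorem 1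
(`RoyRank.Thm1 (padicQbar p) (RoyPadic.logQSpan p) 0`, [Roy1992, §1]).

## References

* [Philippon1986] P. Philippon, *Lemmes de zéros dans les groupes algébriques commutatifs*,
  Bull. Soc. Math. France 114 (1986), 355–383, §2, Théorème 2.1.
* [Waldschmidt1988] M. Waldschmidt, *On the transcendence methods of Gel'fond and Schneider in
  several variables*, New Advances in Transcendence Theory (A. Baker ed.), CUP 1988, 375–398, §7
  Proposition 7.1 (p. 390).
* [NesterenkoPhilippon2001] Yu. V. Nesterenko, P. Philippon (eds.), *Introduction to Algebraic
  Independence Theory*, LNM 1752, Springer 2001, Ch. 11 (D. Roy), Lemma 3.3.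
* [Roy1992] D. Roy, *Matrices whose coefficients are linear forms in logarithms*, J. Number Theory
  41 (1992) 22–47, §1 Theorem 1 (p. 25).
-/

noncomputable section

open MvPolynomial Module

namespace Literature.NumberTheory.Transcendental

namespace LinGroupK

variable {d₀ d₁ : ℕ}

/-! ### `K = ℂ`: the generic vocabulary is the complex one -/

/-- The types agree. [folklore] -/
theorem linGroupK_complex_eq : LinGroupK ℂ d₀ d₁ = LinGroup d₀ d₁ := rfl

/-- `coord` agrees. [folklore] -/
@[simp] theorem coord_complex (g : LinGroupK ℂ d₀ d₁) : coord g = LinGroup.coord g := rfl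

/-- `evalAt` agrees. [folklore] -/
@[simp] theorem evalAt_complex (P : MvPolynomial (Fin d₀ ⊕ Fin d₁) ℂ) (g : LinGroupK ℂ d₀ d₁) :
    evalAt P g = LinGroup.evalAt P g := rfl

/-- `degX` agrees. [folklore] -/
@[simp] theorem degX_complex (P : MvPolynomial (Fin d₀ ⊕ Fin d₁) ℂ) : degX P = LinGroup.degX P := rfl

/-- `degY` agrees. [folklore] -/
@[simp] theorem degY_complex (P : MvPolynomial (Fin d₀ ⊕ Fin d₁) ℂ) : degY P = LinGroup.degY P := rfl

/-- `invDeriv` agrees. [folklore] -/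
@[simp] theorem invDeriv_complex (w : (Fin d₀ → ℂ) × (Fin d₁ → ℂ)) :
    invDeriv (d₀ := d₀) (d₁ := d₁) w = LinGroup.invDeriv w := rfl

/-- `wordDeriv` agrees. [folklore] -/
@[simp] theorem wordDeriv_complex {k : ℕ} (u : Fin k → (Fin d₀ → ℂ) × (Fin d₁ → ℂ))
    (P : MvPolynomial (Fin d₀ ⊕ Fin d₁) ℂ) : wordDeriv u P = LinGroup.wordDeriv u P := by
  induction k generalizing P with
  | zero => rfl
  | succ k ih => rw [wordDeriv_succ, LinGroup.wordDeriv_succ, ih]; rfl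

/-- `sumset` agrees. [folklore] -/
@[simp] theorem sumset_complex (S : Set (LinGroupK ℂ d₀ d₁)) (n : ℕ) : sumset S n = LinGroup.sumset S n := rfl

/-- **The algebraic order of vanishing over `ℂ` is the analytic one.**
[cite: NesterenkoPhilippon2001, Ch. 11 Lemma 3.3] -/
theorem vanishesAlg_iff_vanishesToOrder (P : MvPolynomial (Fin d₀ ⊕ Fin d₁) ℂ)
    (W : Submodule ℂ ((Fin d₀ → ℂ) × (Fin d₁ → ℂ))) (g : LinGroupK ℂ d₀ d₁) (N : ℕ) :
    VanishesAlg P W g N ↔ LinGroup.VanishesToOrder P W g N := by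
  rw [LinGroup.vanishesToOrder_iff_wordDeriv]
  simp only [VanishesAlg, wordDeriv_complex, evalAt_complex]

namespace ConnAlgSubgroup

/-- A generic connected algebraic subgroup over `ℂ`, seen in the tree's complex structure.
[folklore] -/
def toLin (H : ConnAlgSubgroup ℂ d₀ d₁) : LinGroup.ConnAlgSubgroup d₀ d₁ :=
  ⟨H.addPart, H.chars, H.saturated⟩

/-- A complex connected algebraic subgroup of the tree, seen in the generic structure. [folklore] -/
def ofLin (H : LinGroup.ConnAlgSubgroup d₀ d₁) : ConnAlgSubgroup ℂ d₀ d₁ :=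
  ⟨H.addPart, H.chars, H.saturated⟩

/-- Same points. [folklore] -/
@[simp] theorem toSubgroup_toLin (H : ConnAlgSubgroup ℂ d₀ d₁) : H.toLin.toSubgroup = H.toSubgroup := rfl

/-- Same points. [folklore] -/
@[simp] theorem toSubgroup_ofLin (H : LinGroup.ConnAlgSubgroup d₀ d₁) : (ofLin H).toSubgroup = H.toSubgroup := rfl

/-- Same Lie algebra. [folklore] -/
@[simp] theorem tangent_toLin (H : ConnAlgSubgroup ℂ d₀ d₁) : H.toLin.tangent = H.tangent := rfl

/-- Same Lie algebra. [folklore] -/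
@[simp] theorem tangent_ofLin (H : LinGroup.ConnAlgSubgroup d₀ d₁) : (ofLin H).tangent = H.tangent := rfl

/-- Same `dim E`. [folklore] -/
@[simp] theorem addDim_toLin (H : ConnAlgSubgroup ℂ d₀ d₁) : H.toLin.addDim = H.addDim := rfl

/-- Same `dim E`. [folklore] -/
@[simp] theorem addDim_ofLin (H : LinGroup.ConnAlgSubgroup d₀ d₁) : (ofLin H).addDim = H.addDim := rfl

/-- Same `dim T'`. [folklore] -/
@[simp] theorem torusDim_toLin (H : ConnAlgSubgroup ℂ d₀ d₁) : H.toLin.torusDim = H.torusDim := rfl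

/-- Same `dim T'`. [folklore] -/
@[simp] theorem torusDim_ofLin (H : LinGroup.ConnAlgSubgroup d₀ d₁) : (ofLin H).torusDim = H.torusDim := rfl

end ConnAlgSubgroup

/-! ### The zero estimate over `ℂ`: generic predicate versus the complex assembly's hypothesis -/

/-- **`LinGroupK.ZeroEstimate ℂ d₀ d₁` is the hypothesis `hZE` of the complex assembly**
(`LinGroup.weakObstruction_of_zeroEstimate_of_auxiliary`) with its constant existentially
quantified. [cite: Philippon1986, Thm 2.1] [cite: Waldschmidt1988, §7 Proposition 7.1 (p. 390)] -/
theorem zeroEstimate_complex_iff :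
    ZeroEstimate ℂ d₀ d₁ ↔
      ∃ c : ℕ, ∀ (D₀ D₁ T : ℕ) (W : Submodule ℂ ((Fin d₀ → ℂ) × (Fin d₁ → ℂ)))
          (S : Set (LinGroup d₀ d₁)) (P : MvPolynomial (Fin d₀ ⊕ Fin d₁) ℂ),
        1 ≤ D₀ → 1 ≤ D₁ → 0 < finrank ℂ W → S.Finite → (1 : LinGroup d₀ d₁) ∈ S → P ≠ 0 →
        LinGroup.degX P ≤ D₀ → LinGroup.degY P ≤ D₁ →
        (∀ g ∈ LinGroup.sumset S (d₀ + d₁), LinGroup.VanishesToOrder P W g ((d₀ + d₁) * T + 1)) →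
        ∃ H : LinGroup.ConnAlgSubgroup d₀ d₁,
          (∃ g : LinGroup d₀ d₁, ∀ h ∈ H.toSubgroup, LinGroup.evalAt P (g * h) = 0) ∧
          Nat.choose (T + (finrank ℂ W - finrank ℂ ↥(W ⊓ H.tangent)))
              (finrank ℂ W - finrank ℂ ↥(W ⊓ H.tangent)) *
            Set.ncard ((QuotientGroup.mk : LinGroup d₀ d₁ → LinGroup d₀ d₁ ⧸ H.toSubgroup) '' S) *
            D₀ ^ H.addDim * D₁ ^ H.torusDim ≤ c * D₀ ^ d₀ * D₁ ^ d₁ := by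
  constructor
  · rintro ⟨c, hc⟩
    refine ⟨c, fun D₀ D₁ T W S P hD₀ hD₁ hW hS h1 hP hX hY hvan => ?_⟩
    have hvan' : ∀ g ∈ sumset S (d₀ + d₁), VanishesAlg P W g ((d₀ + d₁) * T + 1) := fun g hg =>
      (vanishesAlg_iff_vanishesToOrder P W g _).2 (hvan g hg)
    obtain ⟨H, ⟨g, hg⟩, hineq⟩ := hc D₀ D₁ T W S P hD₀ hD₁ hW hS h1 hP hX hY hvan'
    exact ⟨H.toLin, ⟨g, hg⟩, hineq⟩
  · rintro ⟨c, hc⟩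
    refine ⟨c, fun D₀ D₁ T W S P hD₀ hD₁ hW hS h1 hP hX hY hvan => ?_⟩
    have hvan' : ∀ g ∈ LinGroup.sumset S (d₀ + d₁),
        LinGroup.VanishesToOrder P W g ((d₀ + d₁) * T + 1) := fun g hg =>
      (vanishesAlg_iff_vanishesToOrder P W g _).1 (hvan g hg)
    obtain ⟨H, ⟨g, hg⟩, hineq⟩ := hc D₀ D₁ T W S P hD₀ hD₁ hW hS h1 hP hX hY hvan'
    exact ⟨ConnAlgSubgroup.ofLin H, ⟨g, hg⟩, hineq⟩

/-! ### The zero estimate over `ℚ̄_p` from the complex one -/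

/-- **The complex zero estimate on `𝔾ₐ^{d₀} × 𝔾ₘ^{d₁}` implies the `p`-adic one** (over
`ℚ̄_p = PadicAlgCl p`): transport along an abstract field isomorphism `ℂ ≃+* ℚ̄_p` (Steinitz).
[cite: Philippon1986, §2 ("K = ℂ (ou ℂ_ℓ)") and Thm 2.1] -/
theorem zeroEstimate_padicAlgCl_of_complex (p : ℕ) [Fact p.Prime] (h : ZeroEstimate ℂ d₀ d₁) :
    ZeroEstimate (PadicAlgCl p) d₀ d₁ := by
  obtain ⟨σ⟩ := Complex.nonempty_ringEquiv_padicAlgCl p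
  exact h.of_ringEquiv σ

/-- The same, from the complex assembly's hypothesis `hZE` (with its constant). [cite: Philippon1986, Thm 2.1] -/
theorem zeroEstimate_padicAlgCl_of_complex_hZE (p : ℕ) [Fact p.Prime] (c : ℕ)
    (hZE : ∀ (D₀ D₁ T : ℕ) (W : Submodule ℂ ((Fin d₀ → ℂ) × (Fin d₁ → ℂ)))
        (S : Set (LinGroup d₀ d₁)) (P : MvPolynomial (Fin d₀ ⊕ Fin d₁) ℂ),
      1 ≤ D₀ → 1 ≤ D₁ → 0 < finrank ℂ W → S.Finite → (1 : LinGroup d₀ d₁) ∈ S → P ≠ 0 →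
      LinGroup.degX P ≤ D₀ → LinGroup.degY P ≤ D₁ →
      (∀ g ∈ LinGroup.sumset S (d₀ + d₁), LinGroup.VanishesToOrder P W g ((d₀ + d₁) * T + 1)) →
      ∃ H : LinGroup.ConnAlgSubgroup d₀ d₁,
        (∃ g : LinGroup d₀ d₁, ∀ h ∈ H.toSubgroup, LinGroup.evalAt P (g * h) = 0) ∧
        Nat.choose (T + (finrank ℂ W - finrank ℂ ↥(W ⊓ H.tangent)))
            (finrank ℂ W - finrank ℂ ↥(W ⊓ H.tangent)) *
          Set.ncard ((QuotientGroup.mk : LinGroup d₀ d₁ → LinGroup d₀ d₁ ⧸ H.toSubgroup) '' S) *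
          D₀ ^ H.addDim * D₁ ^ H.torusDim ≤ c * D₀ ^ d₀ * D₁ ^ d₁) :
    ZeroEstimate (PadicAlgCl p) d₀ d₁ :=
  zeroEstimate_padicAlgCl_of_complex p (zeroEstimate_complex_iff.2 ⟨c, hZE⟩)

end LinGroupK

end Literature.NumberTheory.Transcendental
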